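import Summits.QuantumFields.YangMills.Theorems.BalabanUVNodesN15KingModelFullPropagatorPowerLaw
import Summits.QuantumFields.YangMills.Theorems.BalabanUVNodesN15KingModelFullPropagatorGrad
import Summits.QuantumFields.YangMills.Theorems.BalabanUVNodesN15KingModelFullPropagatorOperatorEntries

/-!
# BalabanUVNodes ∕ N15 — THE KING-MODEL RUNG, CURVED EDITION (PART R-c): THE UV PROFILE OF THE GRADIENT `∂^η_μG^η_K` OF THE FULL `A = 0`
# FLUCTUATION PROPAGATOR — `|∂^η_μG^η_K(x, y)| ≤ C·Σ_{i<K} (ΛL)^i·e^{−δ·r·L^i∕L^K}` for ALL pairs, hence the power law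
# `|∂^η_μG^η_K(x, y)| ≤ C′·(L^K∕r)^{d}` (`x ≠ y`) = `C′|x − y|^{1−(d+1)}` in unit coordinates — the (3.63) GRADIENT clause summed over (2.17),
# i.e. the (W1) profile shape, for King's `A = 0` object, UNIFORMLY in `K`, the volume and the mass
# (Track A, DAG node N15 = NE2; FAN-OUT v1.1 §N15 s3 «KING-MODEL RUNG … + the one-line statement of what the curved case adds»)

HONEST FRAMING.  Count-neutral kernel bookkeeping (cell `pub-ymgap`, seat `pub-ymgap-dag-n15-e` g8; `--supports stmt-QuantumFields-20296
--as helper` = K3⁵ `SpineGivenEndpointR13SepCoP`, WORDS-141).  TEMPLATE LITERATURE, `A = 0`: C. King's scalar U(1)-Higgs MODEL on finite tori ([King1986]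
§2.2 p. 653 (2.13)–(2.17), p. 654 (2.20), Theorem 3.3 pp. 655–656 ((3.7) p. 656, derivative clause), Prop. 3.7 (3.63) p. 663 «`|∂^η_μG^η_{(j)}(x, y)| ≤
C(L^jη)^{1−d}·exp[−δ₀(L^jη)^{−1}|x − y|]`», King's `d` = this file's `d + 1`), NOT Bałaban's covariant objects; the full-propagator gradient
profile below is the (2.17)-SUMMED SHAPE of the gradient clause of (3.63) for King's (2.13) at `A = 0`, NOT a printed proposition; NE2⁺ is NOT
PRINTED and not proved here; NOT a node discharge; nothing continuum ∕ ℝ⁴ ∕ OS ∕ mass-gap ∕ Clay.  0 `sorry`, 0 `def`, standard axioms.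

THE POINT.  Parts R-a∕R-b proved the all-pairs level profile and the power law `(L^K∕r)^{d−1}` of the KERNEL of King's full `A = 0` fluctuation
propagator `G(K, M, m²) = constrainedProp (L^K) M (aK a L K) ((L^K)²) m²`.  THIS FILE runs the same induction on the DIFFERENTIATED peel of part
O-a′ (`fullPropD_peel_abs_le`, per-level factor `ΛL = (L^{d+1}∕L²)·L`) for the forward η-derivative in the observation point
`∂G(K, M, m²)_μ(x, y) := L^K·[G(K, M, m²)(x + e_μ, y) − G(K, M, m²)(x, y)]`:
* §1 ★ **`fullPropD_profile_unif`** — `∃ C, δ > 0 ∀ K ≥ 1 ∀ N = L^K ∀ cube 2L^e ∀ 0 < m² ≤ m₀² ∀ μ x y,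
  |∂G(K, M, m²)_μ(x, y)| ≤ C·Σ_{i<K} (ΛL)^i·exp(−δ·r(x, y)·L^i∕L^K)` — ALL pairs (base = [Ba 4] (1.10) clause 2 with a point source,
  `constrainedProp_deriv_decay_blocks_unif`, read in fine distance; step = O-a′'s peel + part M′ `ksDSlice_decay_unif` read in fine distance + IH);
* §2 `LamL_eq_pow` (`ΛL = L^d`), ★★ **`fullPropD_powerLaw_unif`** (`d ≥ 1`): `∀ x ≠ y, |∂G(K, M, m²)_μ(x, y)| ≤ C·((L^K)∕r(x, y))^{d}` — in unit
  coordinates `C·|x − y|^{1−(d+1)}`, the printed gradient exponent `(L^jη)^{1−d}` of (3.63) at the scale `L^jη ≈ |x − y|` (part R-b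
  `levelSum_le_powerLaw` at `p = d`); ★ `fullPropD_diag_le_unif` (`d ≥ 1`, all pairs `≤ C·(L^K)^{d}`); and the SECOND-variable twins
  `fullPropD2_powerLaw_unif` ∕ `fullPropD2_diag_le_unif` (`∂` acting on `y`, through `constrainedProp_symm` — the (W1) spelling `∇_yG_k(x, y)`).
DOWNSTREAM SHAPE SERVED (by name, nothing instantiated): «`|∇_yG_k(x,y)| ≤ C|x − y|^{1−d}` for `1 ≤ |x − y| ≤ L^k`» is the UNPRINTED wall input
(W1) of the T⁴ cell's `T4TwoSpacingDefect.ConsistencySized` (clause (T2), node NE3 = N16; B9 prints unit-cube-localised OPERATOR bounds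
(3.42)–(3.47) and bounded unit-scale kernels only).  §2 is exactly that shape for KING'S `A = 0` OBJECT (fine distance `r ≥ 1`, any `K`, with the
level-`K` lattice-unit normalisation of parts F–R); NOTHING is asserted for Bałaban's `G_k(U)`.
WHAT THE CURVED CASE ADDS (one line): the same gradient profile for `∇_UG_k(U)` uniformly over the live window `Reg335`.
HONEST SCOPE.  (i) `A = 0`, periodic b.c., odd `L ≥ 3`, `0 < m² ≤ m₀²`, cubes `2L^e`; (ii) lattice units of level `K` (the derivative is the forward
difference times `L^K`); (iii) `K ≥ 1`; (iv) §2 needs `d ≥ 1`; (v) not Bałaban's `∇G_k(U)`; not a discharge.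
Locators: [King1986] C. King, CMP **102** (1986) 649–677: (2.13)–(2.17) p. 653, (2.20) p. 654, Theorem 3.3 p. 655, (3.7) p. 656, Prop. 3.7 (3.63)
p. 663, (4.42)–(4.44) p. 675; [Ba 4] = [Balaban1983RegularityDecay] Theorem (1.10) p. 573 (clause 2).
-/

noncomputable section

namespace Summit.QuantumFields.YangMills.BalabanUVNodes.N15KingModelRung.Curved

open Real Finset Matrix
open Literature.MathematicalPhysics.QuantumFieldTheory.Balaban1983to89 (Params)
open Literature.MathematicalPhysics.QuantumFieldTheory.Balaban1983to89.B5Prop11Plancherel (Tor fine unitVec)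
open Literature.MathematicalPhysics.QuantumFieldTheory.King1986 (aK aK_pos)
open Literature.MathematicalPhysics.QuantumFieldTheory.King1986.Torus (constrainedProp flatten blockOf tdistT
  tdistT_nonneg tdistT_symm constrainedProp_deriv_decay_blocks_unif)

variable {d : ℕ} (L : ℕ) [NeZero L]

/-! ## §1 The profile of the gradient: `|∂^η_μG^η_K(x, y)| ≤ C·Σ_{i<K} (ΛL)^i·e^{−δ·r·L^i∕L^K}`, all pairs -/

/-- **THE UV PROFILE OF THE GRADIENT OF KING'S FULL `A = 0` FLUCTUATION PROPAGATOR** (the forward η-derivative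
`L^K·[G^η_K(x + e_μ, y) − G^η_K(x, y)]` of `constrainedProp (L^K) M (aK a L K) ((L^K)²) m²`, level-`K` lattice units): for odd `L ≥ 3`, `a > 0` and
a mass cap `m₀² ≥ 0` there are `C, δ > 0` (functions of `d, L, a, m₀²`) such that for EVERY `K ≥ 1` (any spelling `N = L^K`), cube `M_μ = 2L^e`,
mass `0 < m² ≤ m₀²`, direction `μ` and ALL fine points `x, y` at fine torus distance `r`:
`|∂^η_μG^η_K(x, y)| ≤ C·Σ_{i<K} (ΛL)^i·exp(−δ·r·L^i∕L^K)`, `ΛL = (L^{d+1}∕L²)·L` — the gradient clause of Prop. 3.7 (3.63)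
«`C(L^jη)^{1−d}exp[−δ₀(L^jη)^{−1}|x − y|]`» summed over (2.17), for the FULL propagator, uniformly in `K`.  Induction on `K` (part O-a′'s
differentiated peel + part M′'s gradient-piece decay + [Ba 4] (1.10) clause 2 at the bottom, read in fine distance through part R-a §1).
[cite: King1986, (2.13)–(2.17) p.653, (2.20) p.654, Theorem 3.3 p.655, (3.7) p.656, Prop. 3.7 (3.63) p.663, (4.42)–(4.44) p.675; Balaban1983RegularityDecay, Theorem (1.10) p.573] -/
theorem fullPropD_profile_unif (hLodd : Odd L) (hL : 2 ≤ L) {a : ℝ} (ha : 0 < a) {m0sq : ℝ} (hm0 : 0 ≤ m0sq) :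
    ∃ C δ : ℝ, 0 < C ∧ 0 < δ ∧ ∀ (K : ℕ), 1 ≤ K → ∀ (N : ℕ) [NeZero N], N = L ^ K →
      ∀ (e : ℕ) (M : Fin (d + 1) → ℕ) [∀ μ, NeZero (M μ)], (∀ μ, M μ = 2 * L ^ e) →
      ∀ (msq : ℝ), 0 < msq → msq ≤ m0sq → ∀ (μ : Fin (d + 1)) (x y : Tor (fine N M)),
        |(N : ℝ) * (constrainedProp N M (aK a L K) (((N : ℕ) : ℝ) ^ 2) msq (x + unitVec (fine N M) μ) y
            - constrainedProp N M (aK a L K) (((N : ℕ) : ℝ) ^ 2) msq x y)|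
          ≤ C * ∑ i ∈ Finset.range K, ((L : ℝ) ^ (d + 1) / (L : ℝ) ^ 2 * L) ^ i
              * Real.exp (-(δ * (tdistT (fine N M) x y * (L : ℝ) ^ i / (N : ℝ)))) := by
  have hL1 : 1 < L := by omega
  have hLr : (1 : ℝ) ≤ L := by exact_mod_cast hL1.le
  have hL0 : (0 : ℝ) < L := by positivity
  -- the base constants ([Ba 4] (1.10) clause 2, point source) and the gradient-piece constants (part M′)
  obtain ⟨δb, cb, hδb, hcb, Hb⟩ := constrainedProp_deriv_decay_blocks_unif (d + 1) L (by omega) ⟨hLodd, hL1⟩ ha hm0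
  obtain ⟨Cs, κ, hCs, hκ, Hs⟩ := ksDSlice_decay_unif (d := d) L hLodd hL ha hm0
  -- the constants of the theorem
  set Λ : ℝ := (L : ℝ) ^ (d + 1) / (L : ℝ) ^ 2 * L with hΛdef
  have hΛ : 0 < Λ := by positivity
  set δ : ℝ := min δb κ with hδdef
  have hδ : 0 < δ := lt_min hδb hκ
  have hδb' : δ ≤ δb := min_le_left _ _
  have hδκ : δ ≤ κ := min_le_right _ _
  set C : ℝ := max ((L : ℝ) ^ (d + 1) * cb * Real.exp δb) (Λ * Cs * Real.exp κ) with hCdef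
  have hC : 0 < C := lt_max_of_lt_right (by positivity)
  have hCb : (L : ℝ) ^ (d + 1) * cb * Real.exp δb ≤ C := le_max_left _ _
  have hCsC : Λ * Cs * Real.exp κ ≤ C := le_max_right _ _
  refine ⟨C, δ, hC, hδ, ?_⟩
  intro K hK
  induction K, hK using Nat.le_induction with
  | base =>
    -- `K = 1`: (1.10) clause 2 with a point source, block currency, read in fine distance
    intro N _ hN e M _ hM msq hmsq hcap μ x y
    subst hN
    set P : Params := ⟨d + 1, L, e, 1, by omega, ⟨hLodd, hL1⟩⟩ with hPdef
    have hMK : ∀ μ, M μ = P.sitesPerDir P.K := fun μ => by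
      rw [hM μ]
      simp [hPdef, Params.sitesPerDir]
    have h := Hb P rfl rfl le_rfl msq hmsq.le hcap M hMK (L ^ 1) rfl x y μ
    have hcast : (((L ^ 1 : ℕ) : ℝ)) ^ P.d * cb = (L : ℝ) ^ (d + 1) * cb := by
      simp [hPdef]
    rw [hcast] at h
    set D : ℝ := tdistT M (blockOf (L ^ 1) M x) (blockOf (L ^ 1) M y) with hDdef
    set r : ℝ := tdistT (fine (L ^ 1) M) x y with hrdef
    have hN1 : ((L ^ 1 : ℕ) : ℝ) = L := by push_cast; ring
    have hfine : r ≤ (L : ℝ) * D + ((L : ℝ) - 1) := by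
      have h' := tdistT_fine_le_blocks (L ^ 1) M x y
      rwa [hN1] at h'
    have hexp : Real.exp (-(δb * D)) ≤ Real.exp δb * Real.exp (-(δ * (r / L))) :=
      exp_block_decay_le hLr le_rfl (tdistT_nonneg _ x y) hδ.le hδb' hfine
    rw [Finset.sum_range_one, pow_zero, pow_zero, one_mul, mul_one]
    conv_rhs => rw [hN1]
    calc |(((L ^ 1 : ℕ) : ℝ)) * (constrainedProp (L ^ 1) M (aK a L 1) (((L ^ 1 : ℕ) : ℝ) ^ 2) msq (x + unitVec (fine (L ^ 1) M) μ) y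
            - constrainedProp (L ^ 1) M (aK a L 1) (((L ^ 1 : ℕ) : ℝ) ^ 2) msq x y)|
        ≤ (L : ℝ) ^ (d + 1) * cb * Real.exp (-(δb * D)) := h
      _ ≤ (L : ℝ) ^ (d + 1) * cb * (Real.exp δb * Real.exp (-(δ * (r / L)))) :=
          mul_le_mul_of_nonneg_left hexp (by positivity)
      _ = (L : ℝ) ^ (d + 1) * cb * Real.exp δb * Real.exp (-(δ * (r / L))) := by ring
      _ ≤ C * Real.exp (-(δ * (r / L))) := mul_le_mul_of_nonneg_right hCb (Real.exp_pos _).le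
  | succ K hK IH =>
    intro N _ hN e M _ hM msq hmsq hcap μ x' y'
    subst hN
    obtain rfl : M = fun _ => 2 * L ^ e := funext hM
    set i : KSliceIdx d := ⟨e, K, hK, 1, le_rfl, 0, Nat.zero_le e, 1, le_rfl⟩ with hidef
    obtain ⟨x, rfl⟩ := (flatten (L ^ K) L (ksM L i)).surjective x'
    obtain ⟨y, rfl⟩ := (flatten (L ^ K) L (ksM L i)).surjective y'
    -- the fine distance (preserved by the peel) and the block distance one level down
    set r : ℝ := tdistT (fine (L ^ K) (ksU L i)) x y with hrdef
    set Dsub : ℝ := tdistT (ksU L i) (blockOf (L ^ K) (ksU L i) x) (blockOf (L ^ K) (ksU L i) y) with hDsubdef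
    set NK : ℝ := ((L ^ K : ℕ) : ℝ) with hNKdef
    have hNK1 : 1 ≤ NK := by
      rw [hNKdef]
      exact_mod_cast Nat.one_le_pow K L (by omega)
    have hNK0 : 0 < NK := by linarith
    have hNKL : NK ≤ NK * L := le_mul_of_one_le_right hNK0.le hLr
    have hcastN : ((L ^ K * L : ℕ) : ℝ) = NK * L := by rw [hNKdef]; push_cast; ring
    have hr0 : 0 ≤ r := tdistT_nonneg _ x y
    have hfine : r ≤ NK * Dsub + (NK - 1) := tdistT_fine_le_blocks (L ^ K) (ksU L i) x y
    -- the mass one level down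
    have hL2 : (0 : ℝ) < (L : ℝ) ^ 2 := by positivity
    have hm2 : 0 < msq / (L : ℝ) ^ 2 := div_pos hmsq hL2
    have hm2cap : msq / (L : ℝ) ^ 2 ≤ m0sq := by
      have h1 : (1 : ℝ) ≤ (L : ℝ) ^ 2 := one_le_pow₀ hLr
      exact (div_le_self hmsq.le h1).trans hcap
    -- the induction hypothesis on the finer cube, ALL pairs
    have hM' : ∀ μ, ksU L i μ = 2 * L ^ (e + 1) := fun μ => by
      show L * (2 * L ^ e) = 2 * L ^ (e + 1)
      ring
    have hIH : |((L ^ K : ℕ) : ℝ) *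
          (constrainedProp (L ^ K) (ksU L i) (aK a L K) (((L ^ K : ℕ) : ℝ) ^ 2) (msq / (L : ℝ) ^ 2)
              (x + unitVec (fine (L ^ K) (ksU L i)) μ) y
            - constrainedProp (L ^ K) (ksU L i) (aK a L K) (((L ^ K : ℕ) : ℝ) ^ 2) (msq / (L : ℝ) ^ 2) x y)|
        ≤ C * ∑ j ∈ Finset.range K, Λ ^ j * Real.exp (-(δ * (r * (L : ℝ) ^ j / NK))) :=
      IH (L ^ K) rfl (e + 1) (ksU L i) hM' (msq / (L : ℝ) ^ 2) hm2 hm2cap μ x y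
    -- the gradient-piece decay, read in fine distance at the NEW top scale `NK·L`
    have hS : |ksDSlice L a (msq / (L : ℝ) ^ 2) i μ x y| ≤ Cs * Real.exp (-(κ * Dsub)) :=
      (Hs (msq / (L : ℝ) ^ 2) hm2 hm2cap i μ).1 x y
    have hexpS : Real.exp (-(κ * Dsub)) ≤ Real.exp κ * Real.exp (-(δ * (r / (NK * L)))) :=
      exp_block_decay_le hNK1 hNKL hr0 hδ.le hδκ hfine
    have hS' : |ksDSlice L a (msq / (L : ℝ) ^ 2) i μ x y| ≤ Cs * Real.exp κ * Real.exp (-(δ * (r / (NK * L)))) := by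
      calc |ksDSlice L a (msq / (L : ℝ) ^ 2) i μ x y| ≤ Cs * Real.exp (-(κ * Dsub)) := hS
        _ ≤ Cs * (Real.exp κ * Real.exp (-(δ * (r / (NK * L))))) := mul_le_mul_of_nonneg_left hexpS hCs.le
        _ = Cs * Real.exp κ * Real.exp (-(δ * (r / (NK * L)))) := by ring
    -- the peel
    have hpeel := fullPropD_peel_abs_le L hL ha hmsq i μ x y
    -- the level sums
    have hshift : ∀ j : ℕ, Λ ^ (j + 1) * Real.exp (-(δ * (r * (L : ℝ) ^ (j + 1) / (NK * L))))
        = Λ * (Λ ^ j * Real.exp (-(δ * (r * (L : ℝ) ^ j / NK)))) := fun j => by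
      have he : r * (L : ℝ) ^ (j + 1) / (NK * L) = r * (L : ℝ) ^ j / NK := by
        rw [pow_succ, ← mul_assoc, mul_div_mul_right _ _ hL0.ne']
      rw [he, pow_succ]
      ring
    have hsum : ∑ j ∈ Finset.range (K + 1), Λ ^ j * Real.exp (-(δ * (r * (L : ℝ) ^ j / (NK * L))))
        = Real.exp (-(δ * (r / (NK * L))))
          + Λ * ∑ j ∈ Finset.range K, Λ ^ j * Real.exp (-(δ * (r * (L : ℝ) ^ j / NK))) := by
      rw [Finset.sum_range_succ', pow_zero, pow_zero, one_mul, mul_one, Finset.mul_sum, add_comm]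
      congr 1
      exact Finset.sum_congr rfl fun j _ => hshift j
    -- the goal in the peel's spelling, fine distance through `tdistT_flatten`
    show |((L ^ K * L : ℕ) : ℝ) *
            (constrainedProp (L ^ K * L) (ksM L i) (aK a L (K + 1)) (((L ^ K * L : ℕ) : ℝ) ^ 2) msq
                (flatten (L ^ K) L (ksM L i) x + unitVec (fine (L ^ K * L) (ksM L i)) μ) (flatten (L ^ K) L (ksM L i) y)
              - constrainedProp (L ^ K * L) (ksM L i) (aK a L (K + 1)) (((L ^ K * L : ℕ) : ℝ) ^ 2) msq
                (flatten (L ^ K) L (ksM L i) x) (flatten (L ^ K) L (ksM L i) y))|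
        ≤ C * ∑ j ∈ Finset.range (K + 1), Λ ^ j * Real.exp (-(δ *
            (tdistT (fine (L ^ K * L) (ksM L i)) (flatten (L ^ K) L (ksM L i) x) (flatten (L ^ K) L (ksM L i) y)
              * (L : ℝ) ^ j / ((L ^ K * L : ℕ) : ℝ))))
    conv_rhs => rw [tdistT_flatten, hcastN, ← hrdef, hsum]
    calc |((L ^ K * L : ℕ) : ℝ) *
            (constrainedProp (L ^ K * L) (ksM L i) (aK a L (K + 1)) (((L ^ K * L : ℕ) : ℝ) ^ 2) msq
                (flatten (L ^ K) L (ksM L i) x + unitVec (fine (L ^ K * L) (ksM L i)) μ) (flatten (L ^ K) L (ksM L i) y)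
              - constrainedProp (L ^ K * L) (ksM L i) (aK a L (K + 1)) (((L ^ K * L : ℕ) : ℝ) ^ 2) msq
                (flatten (L ^ K) L (ksM L i) x) (flatten (L ^ K) L (ksM L i) y))|
        ≤ Λ * (|((L ^ K : ℕ) : ℝ) *
              (constrainedProp (L ^ K) (ksU L i) (aK a L K) (((L ^ K : ℕ) : ℝ) ^ 2) (msq / (L : ℝ) ^ 2)
                  (x + unitVec (fine (L ^ K) (ksU L i)) μ) y
                - constrainedProp (L ^ K) (ksU L i) (aK a L K) (((L ^ K : ℕ) : ℝ) ^ 2) (msq / (L : ℝ) ^ 2) x y)|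
            + |ksDSlice L a (msq / (L : ℝ) ^ 2) i μ x y|) := hpeel
      _ ≤ Λ * (C * ∑ j ∈ Finset.range K, Λ ^ j * Real.exp (-(δ * (r * (L : ℝ) ^ j / NK)))
            + Cs * Real.exp κ * Real.exp (-(δ * (r / (NK * L))))) :=
          mul_le_mul_of_nonneg_left (add_le_add hIH hS') hΛ.le
      _ = C * (Λ * ∑ j ∈ Finset.range K, Λ ^ j * Real.exp (-(δ * (r * (L : ℝ) ^ j / NK))))
            + Λ * Cs * Real.exp κ * Real.exp (-(δ * (r / (NK * L)))) := by ring
      _ ≤ C * (Λ * ∑ j ∈ Finset.range K, Λ ^ j * Real.exp (-(δ * (r * (L : ℝ) ^ j / NK))))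
            + C * Real.exp (-(δ * (r / (NK * L)))) := by
          have := mul_le_mul_of_nonneg_right hCsC (Real.exp_pos (-(δ * (r / (NK * L))))).le
          linarith
      _ = C * (Real.exp (-(δ * (r / (NK * L))))
            + Λ * ∑ j ∈ Finset.range K, Λ ^ j * Real.exp (-(δ * (r * (L : ℝ) ^ j / NK)))) := by ring

/-! ## §2 The power law `|∂^η_μG^η_K(x, y)| ≤ C·(L^K∕r)^{d}` for `x ≠ y`, the diagonal order `(L^K)^{d}`, and the `∇_y` twins -/

omit [NeZero L] in
/-- `ΛL = (L^{d+1}∕L²)·L = L^{d}`. [cite: King1986, (2.20) p.654] -/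
theorem LamL_eq_pow (hL : 2 ≤ L) : (L : ℝ) ^ (d + 1) / (L : ℝ) ^ 2 * L = (L : ℝ) ^ d := by
  have hL0 : (L : ℝ) ≠ 0 := by exact_mod_cast (show L ≠ 0 by omega)
  field_simp
  ring

/-- **THE POWER LAW FOR THE GRADIENT: KING'S (3.63), GRADIENT CLAUSE, SUMMED, FOR THE FULL `A = 0` PROPAGATOR** (`d ≥ 1`): for odd `L ≥ 3`,
`a > 0`, `m₀² ≥ 0` there is `C > 0` (a function of `d, L, a, m₀²`) such that for EVERY `K ≥ 1` (any spelling `N = L^K`), cube `M_μ = 2L^e`, mass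
`0 < m² ≤ m₀²`, direction `μ` and all DISTINCT fine points `x ≠ y` (fine torus distance `r ≥ 1`):
`|∂^η_μG^η_K(x, y)| ≤ C·(L^K∕r)^{d}` — in unit coordinates the Theorem 3.3 ∕ [Ba 4]-type gradient singularity `C·|x − y|^{1−(d+1)}` (the printed
exponent `(L^jη)^{1−d}` of (3.63) at the scale `L^jη ≈ |x − y|`), UNIFORM in `K`, the volume and the mass; = the (W1) shape «`|∇G_k(x, y)| ≤
C|x − y|^{1−d}`, `1 ≤ |x − y| ≤ L^k`» of `T4TwoSpacingDefect.ConsistencySized` for KING'S `A = 0` object (§1 + part R-b `levelSum_le_powerLaw`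
at `p = d`).  NOT a printed proposition; nothing here is Bałaban's `∇G_k(U)`. [cite: King1986, (2.13)–(2.17) p.653, Theorem 3.3 p.655, (3.7) p.656, Prop. 3.7 (3.63) p.663; Balaban1983RegularityDecay, Theorem (1.10) p.573] -/
theorem fullPropD_powerLaw_unif (hd : 1 ≤ d) (hLodd : Odd L) (hL : 2 ≤ L) {a : ℝ} (ha : 0 < a) {m0sq : ℝ} (hm0 : 0 ≤ m0sq) :
    ∃ C : ℝ, 0 < C ∧ ∀ (K : ℕ), 1 ≤ K → ∀ (N : ℕ) [NeZero N], N = L ^ K →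
      ∀ (e : ℕ) (M : Fin (d + 1) → ℕ) [∀ μ, NeZero (M μ)], (∀ μ, M μ = 2 * L ^ e) →
      ∀ (msq : ℝ), 0 < msq → msq ≤ m0sq → ∀ (μ : Fin (d + 1)) (x y : Tor (fine N M)), x ≠ y →
        |(N : ℝ) * (constrainedProp N M (aK a L K) (((N : ℕ) : ℝ) ^ 2) msq (x + unitVec (fine N M) μ) y
            - constrainedProp N M (aK a L K) (((N : ℕ) : ℝ) ^ 2) msq x y)|
          ≤ C * (((L : ℝ) ^ K) / tdistT (fine N M) x y) ^ d := by
  have hLr : (2 : ℝ) ≤ L := by exact_mod_cast hL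
  have hL0 : (0 : ℝ) < L := by linarith
  obtain ⟨C₀, δ, hC₀, hδ, H⟩ := fullPropD_profile_unif (d := d) L hLodd hL ha hm0
  set Kp : ℝ := (2 * (d + 1).factorial / (δ / L) ^ (d + 1) + 2) / (L : ℝ) ^ d with hKp
  have hKp0 : 0 < Kp := by positivity
  refine ⟨C₀ * Kp, mul_pos hC₀ hKp0, ?_⟩
  intro K hK N _ hN e M _ hM msq hmsq hcap μ x y hxy
  have h := H K hK N hN e M hM msq hmsq hcap μ x y
  set r : ℝ := tdistT (fine N M) x y with hrdef
  have hr : 1 ≤ r := one_le_tdistT_of_ne (fine N M) hxy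
  have hNc : (N : ℝ) = (L : ℝ) ^ K := by rw [hN]; push_cast; ring
  have hs : ∑ i ∈ Finset.range K, ((L : ℝ) ^ (d + 1) / (L : ℝ) ^ 2 * L) ^ i * Real.exp (-(δ * (r * (L : ℝ) ^ i / (N : ℝ))))
      = ∑ i ∈ Finset.range K, ((L : ℝ) ^ d) ^ i * Real.exp (-(δ * (r * (L : ℝ) ^ i / (L : ℝ) ^ K))) :=
    Finset.sum_congr rfl fun i _ => by rw [LamL_eq_pow L hL, hNc]
  rw [hs] at h
  have hsum := levelSum_le_powerLaw hLr hδ hd K hr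
  calc |(N : ℝ) * (constrainedProp N M (aK a L K) (((N : ℕ) : ℝ) ^ 2) msq (x + unitVec (fine N M) μ) y
          - constrainedProp N M (aK a L K) (((N : ℕ) : ℝ) ^ 2) msq x y)|
      ≤ C₀ * ∑ i ∈ Finset.range K, ((L : ℝ) ^ d) ^ i * Real.exp (-(δ * (r * (L : ℝ) ^ i / (L : ℝ) ^ K))) := h
    _ ≤ C₀ * (Kp * (((L : ℝ) ^ K) / r) ^ d) := mul_le_mul_of_nonneg_left hsum hC₀.le
    _ = C₀ * Kp * (((L : ℝ) ^ K) / r) ^ d := by ring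

/-- **THE DIAGONAL ORDER OF THE GRADIENT** (`d ≥ 1`): `∃ C > 0 ∀ K ≥ 1 … ∀ μ x y, |∂^η_μG^η_K(x, y)| ≤ C·(L^K)^{d}` — all pairs, the diagonal included
(the `j = 0` gradient exponent `(L^jη)^{1−d}` of (3.63) at `L^jη = η`; §1 + part R-b `levelSum_le_geom`). [cite: King1986, Prop. 3.7 (3.63) p.663, (2.20) p.654] -/
theorem fullPropD_diag_le_unif (hd : 1 ≤ d) (hLodd : Odd L) (hL : 2 ≤ L) {a : ℝ} (ha : 0 < a) {m0sq : ℝ} (hm0 : 0 ≤ m0sq) :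
    ∃ C : ℝ, 0 < C ∧ ∀ (K : ℕ), 1 ≤ K → ∀ (N : ℕ) [NeZero N], N = L ^ K →
      ∀ (e : ℕ) (M : Fin (d + 1) → ℕ) [∀ μ, NeZero (M μ)], (∀ μ, M μ = 2 * L ^ e) →
      ∀ (msq : ℝ), 0 < msq → msq ≤ m0sq → ∀ (μ : Fin (d + 1)) (x y : Tor (fine N M)),
        |(N : ℝ) * (constrainedProp N M (aK a L K) (((N : ℕ) : ℝ) ^ 2) msq (x + unitVec (fine N M) μ) y
            - constrainedProp N M (aK a L K) (((N : ℕ) : ℝ) ^ 2) msq x y)| ≤ C * (((L : ℝ) ^ K)) ^ d := by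
  have hLr : (2 : ℝ) ≤ L := by exact_mod_cast hL
  have hL0 : (0 : ℝ) < L := by linarith
  obtain ⟨C₀, δ, hC₀, hδ, H⟩ := fullPropD_profile_unif (d := d) L hLodd hL ha hm0
  refine ⟨C₀, hC₀, ?_⟩
  intro K hK N _ hN e M _ hM msq hmsq hcap μ x y
  have h := H K hK N hN e M hM msq hmsq hcap μ x y
  rw [LamL_eq_pow L hL] at h
  have hΛ2 : (2 : ℝ) ≤ (L : ℝ) ^ d := by
    calc (2 : ℝ) ≤ L := hLr
      _ = (L : ℝ) ^ 1 := (pow_one _).symm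
      _ ≤ (L : ℝ) ^ d := pow_le_pow_right₀ (by linarith) hd
  have hgeom := levelSum_le_geom hΛ2 K (fun i => Real.exp (-(δ * (tdistT (fine N M) x y * (L : ℝ) ^ i / (N : ℝ)))))
    (fun i => Real.exp_le_one_iff.mpr (by
      have := tdistT_nonneg (fine N M) x y
      have : 0 ≤ δ * (tdistT (fine N M) x y * (L : ℝ) ^ i / (N : ℝ)) := by positivity
      linarith))
  calc |(N : ℝ) * (constrainedProp N M (aK a L K) (((N : ℕ) : ℝ) ^ 2) msq (x + unitVec (fine N M) μ) y
          - constrainedProp N M (aK a L K) (((N : ℕ) : ℝ) ^ 2) msq x y)|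
      ≤ C₀ * ∑ i ∈ Finset.range K, ((L : ℝ) ^ d) ^ i
          * Real.exp (-(δ * (tdistT (fine N M) x y * (L : ℝ) ^ i / (N : ℝ)))) := h
    _ ≤ C₀ * ((L : ℝ) ^ d) ^ K := mul_le_mul_of_nonneg_left hgeom hC₀.le
    _ = C₀ * ((L : ℝ) ^ K) ^ d := by rw [← pow_mul, ← pow_mul, Nat.mul_comm]

/-- **The `∇_y` twin of the power law** (`d ≥ 1`): the forward η-derivative in the SOURCE point, `L^K·[G^η_K(x, y + e_μ) − G^η_K(x, y)]`, obeys
the same bound `C·(L^K∕r)^{d}` for `x ≠ y` — `G^η_K` is symmetric (part Q4a `constrainedProp_symm`) and the torus distance is symmetric; this is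
the spelling «`∇_yG_k(x, y)`» of the (W1) profile. [cite: King1986, (2.13) p.653, Prop. 3.7 (3.63) p.663] -/
theorem fullPropD2_powerLaw_unif (hd : 1 ≤ d) (hLodd : Odd L) (hL : 2 ≤ L) {a : ℝ} (ha : 0 < a) {m0sq : ℝ} (hm0 : 0 ≤ m0sq) :
    ∃ C : ℝ, 0 < C ∧ ∀ (K : ℕ), 1 ≤ K → ∀ (N : ℕ) [NeZero N], N = L ^ K →
      ∀ (e : ℕ) (M : Fin (d + 1) → ℕ) [∀ μ, NeZero (M μ)], (∀ μ, M μ = 2 * L ^ e) →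
      ∀ (msq : ℝ), 0 < msq → msq ≤ m0sq → ∀ (μ : Fin (d + 1)) (x y : Tor (fine N M)), x ≠ y →
        |(N : ℝ) * (constrainedProp N M (aK a L K) (((N : ℕ) : ℝ) ^ 2) msq x (y + unitVec (fine N M) μ)
            - constrainedProp N M (aK a L K) (((N : ℕ) : ℝ) ^ 2) msq x y)|
          ≤ C * (((L : ℝ) ^ K) / tdistT (fine N M) x y) ^ d := by
  obtain ⟨C, hC, H⟩ := fullPropD_powerLaw_unif (d := d) L hd hLodd hL ha hm0
  refine ⟨C, hC, ?_⟩
  intro K hK N _ hN e M _ hM msq hmsq hcap μ x y hxy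
  have h := H K hK N hN e M hM msq hmsq hcap μ y x (Ne.symm hxy)
  rw [constrainedProp_symm N M _ _ _ (y + _) x, constrainedProp_symm N M _ _ _ y x, tdistT_symm] at h
  exact h

/-- **The `∇_y` twin of the diagonal order** (`d ≥ 1`): `|L^K·[G^η_K(x, y + e_μ) − G^η_K(x, y)]| ≤ C·(L^K)^{d}` for all pairs.
[cite: King1986, (2.13) p.653, Prop. 3.7 (3.63) p.663] -/
theorem fullPropD2_diag_le_unif (hd : 1 ≤ d) (hLodd : Odd L) (hL : 2 ≤ L) {a : ℝ} (ha : 0 < a) {m0sq : ℝ} (hm0 : 0 ≤ m0sq) :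
    ∃ C : ℝ, 0 < C ∧ ∀ (K : ℕ), 1 ≤ K → ∀ (N : ℕ) [NeZero N], N = L ^ K →
      ∀ (e : ℕ) (M : Fin (d + 1) → ℕ) [∀ μ, NeZero (M μ)], (∀ μ, M μ = 2 * L ^ e) →
      ∀ (msq : ℝ), 0 < msq → msq ≤ m0sq → ∀ (μ : Fin (d + 1)) (x y : Tor (fine N M)),
        |(N : ℝ) * (constrainedProp N M (aK a L K) (((N : ℕ) : ℝ) ^ 2) msq x (y + unitVec (fine N M) μ)
            - constrainedProp N M (aK a L K) (((N : ℕ) : ℝ) ^ 2) msq x y)| ≤ C * (((L : ℝ) ^ K)) ^ d := by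
  obtain ⟨C, hC, H⟩ := fullPropD_diag_le_unif (d := d) L hd hLodd hL ha hm0
  refine ⟨C, hC, ?_⟩
  intro K hK N _ hN e M _ hM msq hmsq hcap μ x y
  have h := H K hK N hN e M hM msq hmsq hcap μ y x
  rw [constrainedProp_symm N M _ _ _ (y + _) x, constrainedProp_symm N M _ _ _ y x] at h
  exact h

end Summit.QuantumFields.YangMills.BalabanUVNodes.N15KingModelRung.Curved
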